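import Summits.AnomalousDissipation.AnomalousDissipation.Theorems.MarginalStabilityChainStrainedLayerLawStubVorticityUniformBoundsC
import Mathlib.MeasureTheory.Integral.Average
import Mathlib.Analysis.SpecialFunctions.Pow.Real

/-!
# Stub `stub_vorticityUniformBounds` (crux stmt-AnomalousDissipation-3007, line `strain-work-sum-rule`) — tools I:
# Ladyzhenskaya's inequality on the cylinder `ℝ/Lℤ × ℝ`

Support file (`--supports stmt-AnomalousDissipation-3007`; registered sub-goal `stub_vorticityUniformBounds_ladyzhenskaya`).
For `f ∈ C¹(ℝ²)`, `L`-periodic in `x`, with `|f|, |∂ₓf| + |∂_yf| ≤ Ce^{−k|y|}`: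
`∫∫_cell f⁴ ≤ [L⁻¹∫∫f² + 2‖f‖₂‖∂ₓf‖₂]·[2‖f‖₂‖∂_yf‖₂]` (cell `(0, L] × ℝ`) — the periodic Agmon bound in `x`
(`f² ≤ L⁻¹∫f² + ∫|∂ₓ(f²)|` along a period), the Agmon bound across the layer (`f² ≤ ∫|∂_y(f²)|`), their product
integrated over the cell (Fubini factorises it) and Cauchy–Schwarz on the strip (`kato_strip_cauchySchwarz`). The first
factor carries the one-dimensional (large-scale) branch `L⁻¹‖f‖₂²` of the cylinder; this elementary inequality replaces
Nash/Gagliardo–Nirenberg (not available on the cylinder) in the enstrophy step (c′) of the a-priori chain.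
All `[folklore]` (O. A. Ladyzhenskaya's inequality; cylinder variant).
-/

-- `Summit.<Summit>.<Problem>` is the tree's mandated summit-side namespace (CONVENTIONS §2); for this
-- single-conjunct summit the two coincide, so the duplicate is deliberate.
set_option linter.dupNamespace false

noncomputable section

open scoped Topology ENNReal
open Filter Set Function MeasureTheory

namespace Summit.AnomalousDissipation.AnomalousDissipation.Theorems.StrainedLayerLaw.StrainWorkSumRule

open Literature.Analysis.FluidPDE Literature.Analysis.FluidPDE.StretchedLayer
open Summit.AnomalousDissipation.AnomalousDissipation.Theorems.MarginalStabilityChainStretchedVortexRows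

/-! ## Cauchy–Schwarz on the period strip -/

section StripCS

/-- **Cauchy–Schwarz on the period strip** for continuous `φ, χ` with `φ², χ²` integrable:
`∫∫ |φ||χ| ≤ √(∫∫ φ²) √(∫∫ χ²)` (Mathlib's Hölder `integral_mul_le_Lp_mul_Lq_of_nonneg` with `p = q = 2`).
[folklore] -/
theorem kato_strip_cauchySchwarz {L : ℝ} {φ χ : ℝ × ℝ → ℝ} (hφ : Continuous φ) (hχ : Continuous χ)
    (hφ2 : IntegrableOn (fun q => φ q ^ 2) (Ioc 0 L ×ˢ univ)) (hχ2 : IntegrableOn (fun q => χ q ^ 2) (Ioc 0 L ×ˢ univ)) :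
    ∫ q in Ioc 0 L ×ˢ univ, |φ q| * |χ q| ≤
      Real.sqrt (∫ q in Ioc 0 L ×ˢ univ, φ q ^ 2) * Real.sqrt (∫ q in Ioc 0 L ×ˢ univ, χ q ^ 2) := by
  -- adapted from `Literature…TaoEnergyLocalisation.integral_mul_le_sqrt_mul_sqrt`
  have h := integral_mul_le_Lp_mul_Lq_of_nonneg (μ := volume.restrict (Ioc 0 L ×ˢ univ))
    Real.HolderConjugate.two_two (f := fun q => |φ q|) (g := fun q => |χ q|)
    (Eventually.of_forall fun q => abs_nonneg _) (Eventually.of_forall fun q => abs_nonneg _)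
    (by
      rw [ENNReal.ofReal_ofNat]
      have h : IntegrableOn (fun q => |φ q| ^ 2) (Ioc 0 L ×ˢ univ) := by simpa only [sq_abs] using hφ2
      exact (memLp_two_iff_integrable_sq hφ.abs.aestronglyMeasurable).2 h)
    (by
      rw [ENNReal.ofReal_ofNat]
      have h : IntegrableOn (fun q => |χ q| ^ 2) (Ioc 0 L ×ˢ univ) := by simpa only [sq_abs] using hχ2
      exact (memLp_two_iff_integrable_sq hχ.abs.aestronglyMeasurable).2 h)
  simp only [Real.rpow_two, sq_abs] at h
  rwa [Real.sqrt_eq_rpow, Real.sqrt_eq_rpow]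

end StripCS

/-! ## Ladyzhenskaya's inequality on the cylinder `ℝ/Lℤ × ℝ` -/

section Ladyzhenskaya

variable {L C k : ℝ} {f : ℝ → ℝ → ℝ}

/-- **Periodic Agmon bound in `x`.** For `f ∈ C¹` and `x ∈ [0, L]` (`L > 0`):
`f(x,y)² ≤ L⁻¹ ∫_{(0,L]} f(·,y)² + ∫_{(0,L]} |2 f ∂ₓf|(·,y)` (some point of the period is below the mean; the
fundamental theorem of calculus for `f²` along the period). [folklore] -/
theorem kato_sq_le_mean_add_variation (hL : 0 < L) (hf : ContDiff ℝ 1 (fun q : ℝ × ℝ => f q.1 q.2)) {x : ℝ}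
    (hx : x ∈ Icc 0 L) (y : ℝ) :
    f x y ^ 2 ≤ L⁻¹ * (∫ s in Ioc 0 L, f s y ^ 2) + ∫ s in Ioc 0 L, |2 * f s y * dX f s y| := by
  have hfx : ∀ s, HasDerivAt (fun s => f s y) (dX f s y) s := fun s => hasDerivAt_dX_of_contDiff hf one_ne_zero s y
  have hg : ∀ s, HasDerivAt (fun s => f s y ^ 2) (2 * f s y * dX f s y) s := fun s => by
    have h := (hfx s).mul (hfx s)
    have e : (fun s => f s y ^ 2) = fun s => f s y * f s y := funext fun s => sq _
    rw [e]
    exact h.congr_deriv (by ring)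
  have cfs : Continuous fun s => f s y := hf.continuous.comp (continuous_id.prodMk continuous_const)
  have cg : Continuous fun s => f s y ^ 2 := cfs.pow 2
  have cg' : Continuous fun s => 2 * f s y * dX f s y :=
    (continuous_const.mul cfs).mul ((continuous_dX hf).comp (continuous_id.prodMk continuous_const))
  -- a point below the mean
  have hvol : volume (Ioc (0:ℝ) L) ≠ 0 := by
    rw [Real.volume_Ioc, sub_zero]; exact (ENNReal.ofReal_pos.2 hL).ne'
  obtain ⟨x₀, hx₀, hle⟩ := exists_le_setAverage (μ := volume) hvol measure_Ioc_lt_top.ne cg.integrableOn_Ioc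
  rw [setAverage_eq, smul_eq_mul, Real.volume_real_Ioc_of_le hL.le, sub_zero] at hle
  -- the fundamental theorem of calculus between `x₀` and `x`
  have hftc : ∫ s in x₀..x, 2 * f s y * dX f s y = f x y ^ 2 - f x₀ y ^ 2 :=
    intervalIntegral.integral_eq_sub_of_hasDerivAt (fun s _ => hg s) (cg'.intervalIntegrable _ _)
  have hsub : uIoc x₀ x ⊆ Ioc 0 L := by
    intro s hs
    rw [mem_uIoc] at hs
    rcases hs with ⟨h1, h2⟩ | ⟨h1, h2⟩
    · exact ⟨hx₀.1.trans h1, h2.trans hx.2⟩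
    · exact ⟨hx.1.trans_lt h1, h2.trans hx₀.2⟩
  have hbound : |∫ s in x₀..x, 2 * f s y * dX f s y| ≤ ∫ s in Ioc 0 L, |2 * f s y * dX f s y| := by
    have h := intervalIntegral.norm_integral_le_integral_norm_uIoc (f := fun s => 2 * f s y * dX f s y)
      (a := x₀) (b := x) (μ := volume)
    simp only [Real.norm_eq_abs] at h
    exact h.trans (setIntegral_mono_set cg'.abs.integrableOn_Ioc (Eventually.of_forall fun s => abs_nonneg _)
      (Eventually.of_forall hsub))
  have h1 : f x y ^ 2 - f x₀ y ^ 2 ≤ ∫ s in Ioc 0 L, |2 * f s y * dX f s y| := by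
    rw [← hftc]; exact (le_abs_self _).trans hbound
  linarith

/-- **Agmon bound across the layer.** For `f ∈ C¹` with `|f|, |∂_yf| ≤ Ce^{−k|y|}` (`k > 0`):
`f(x,y)² ≤ ∫_ℝ |2 f ∂_yf|(x,·)` (`f(x,·)² = ∫_{−∞}^y ∂_y(f²)`). [folklore] -/
theorem kato_sq_le_integral_dY (hk : 0 < k) (hf : ContDiff ℝ 1 (fun q : ℝ × ℝ => f q.1 q.2))
    (hfb : ∀ x y, |f x y| ≤ C * Real.exp (-k * |y|)) (hfy : ∀ x y, |dY f x y| ≤ C * Real.exp (-k * |y|))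
    (x y : ℝ) : f x y ^ 2 ≤ ∫ s, |2 * f x s * dY f x s| := by
  have hC : 0 ≤ C := by
    have h := (abs_nonneg _).trans (hfb 0 0)
    rw [abs_zero, mul_zero, Real.exp_zero, mul_one] at h; exact h
  have hfyd : ∀ s, HasDerivAt (fun s => f x s) (dY f x s) s := fun s => hasDerivAt_dY_of_contDiff hf one_ne_zero x s
  have hg : ∀ s, HasDerivAt (fun s => f x s ^ 2) (2 * f x s * dY f x s) s := fun s => by
    have h := (hfyd s).mul (hfyd s)
    have e : (fun s => f x s ^ 2) = fun s => f x s * f x s := funext fun s => sq _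
    rw [e]
    exact h.congr_deriv (by ring)
  have cfs : Continuous fun s => f x s := hf.continuous.comp (continuous_const.prodMk continuous_id)
  have cg' : Continuous fun s => 2 * f x s * dY f x s :=
    (continuous_const.mul cfs).mul ((continuous_dY hf).comp (continuous_const.prodMk continuous_id))
  -- integrability of `g′` on `ℝ`: `|2 f f_y| ≤ 2C² e^{−k|s|} ≤ 2C² (1+|s|)² e^{−k|s|}`
  have hle1 : ∀ s, Real.exp (-k * |s|) ≤ 1 := fun s => Real.exp_le_one_iff.2 (by nlinarith [abs_nonneg s])
  have hg'b : ∀ s, |2 * f x s * dY f x s| ≤ 2 * C ^ 2 * ((1 + |s|) ^ 2 * Real.exp (-k * |s|)) := fun s => by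
    rw [abs_mul, abs_mul, abs_two]
    have h1 := hfb x s; have h2 := hfy x s; have h3 := hle1 s; have h4 := exp_le_one_add_abs_sq_mul_exp k s
    have h5 : |f x s| ≤ C := h1.trans (by nlinarith)
    calc 2 * |f x s| * |dY f x s| ≤ 2 * C * (C * Real.exp (-k * |s|)) :=
          mul_le_mul (by linarith) h2 (abs_nonneg _) (by positivity)
      _ = 2 * C ^ 2 * Real.exp (-k * |s|) := by ring
      _ ≤ 2 * C ^ 2 * ((1 + |s|) ^ 2 * Real.exp (-k * |s|)) := mul_le_mul_of_nonneg_left h4 (by positivity)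
  have hI : Integrable fun s => 2 * f x s * dY f x s :=
    Integrable.mono' ((integrable_one_add_abs_sq_mul_exp hk).const_mul (2 * C ^ 2)) cg'.aestronglyMeasurable
      (Eventually.of_forall fun s => by rw [Real.norm_eq_abs]; exact hg'b s)
  -- `f(x,s)² → 0` as `s → −∞`
  have hlim : Tendsto (fun s => f x s ^ 2) atBot (𝓝 0) := by
    refine tendsto_zero_atBot_of_abs_le_exp (K := C * C) hk fun s => ?_
    rw [abs_pow, sq_abs, sq]
    have h1 := hfb x s
    have h5 : |f x s| ≤ C := h1.trans (by nlinarith [hle1 s])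
    calc f x s * f x s ≤ |f x s| * |f x s| := by nlinarith [abs_mul_abs_self (f x s)]
      _ ≤ C * (C * Real.exp (-k * |s|)) := mul_le_mul h5 h1 (abs_nonneg _) hC
      _ = C * C * Real.exp (-k * |s|) := by ring
  have hftc := integral_Iic_of_hasDerivAt_of_tendsto' (a := y) (fun s _ => hg s) hI.integrableOn hlim
  rw [sub_zero] at hftc
  rw [← hftc]
  calc ∫ s in Iic y, 2 * f x s * dY f x s ≤ ∫ s in Iic y, |2 * f x s * dY f x s| :=
        setIntegral_mono hI.integrableOn hI.abs.integrableOn fun s => le_abs_self _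
    _ ≤ ∫ s, |2 * f x s * dY f x s| :=
        setIntegral_le_integral hI.abs (Eventually.of_forall fun s => abs_nonneg _)

/-- **Ladyzhenskaya's inequality on the cylinder (registered sub-goal `stub_vorticityUniformBounds_ladyzhenskaya`).**
For `f ∈ C¹(ℝ²)`, `L`-periodic in `x` (`L > 0`), with `|f|, |∂ₓf| + |∂_yf| ≤ Ce^{−k|y|}` (`k > 0`):
`∫∫_cell f⁴ ≤ [L⁻¹∫∫f² + 2‖f‖₂‖∂ₓf‖₂] · [2‖f‖₂‖∂_yf‖₂]` (cell `(0,L] × ℝ`, `‖·‖₂ = √∫∫(·)²`): multiply the two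
Agmon bounds `f² ≤ a(y)`, `f² ≤ b(x)`, integrate (the right-hand side factorises, Fubini), and Cauchy–Schwarz. The
first factor carries the 1-D (large-scale) branch `L⁻¹‖f‖₂²` of the cylinder. [folklore] -/
theorem stub_vorticityUniformBounds_ladyzhenskaya : ∀ (L C k : ℝ) (f : ℝ → ℝ → ℝ), 0 < L → 0 < k →
    ContDiff ℝ 1 (fun q : ℝ × ℝ => f q.1 q.2) → (∀ x y, f (x + L) y = f x y) →
    (∀ x y, |f x y| ≤ C * Real.exp (-k * |y|)) → (∀ x y, |dX f x y| + |dY f x y| ≤ C * Real.exp (-k * |y|)) →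
      ∫ q in Ioc 0 L ×ˢ univ, f q.1 q.2 ^ 4 ≤
        (L⁻¹ * (∫ q in Ioc 0 L ×ˢ univ, f q.1 q.2 ^ 2) +
          2 * Real.sqrt (∫ q in Ioc 0 L ×ˢ univ, f q.1 q.2 ^ 2) * Real.sqrt (∫ q in Ioc 0 L ×ˢ univ, dX f q.1 q.2 ^ 2)) *
        (2 * Real.sqrt (∫ q in Ioc 0 L ×ˢ univ, f q.1 q.2 ^ 2) * Real.sqrt (∫ q in Ioc 0 L ×ˢ univ, dY f q.1 q.2 ^ 2)) := by
  intro L C k f hL hk hf hper hfb hgrad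
  have hC : 0 ≤ C := by
    have h := (abs_nonneg _).trans (hfb 0 0)
    rw [abs_zero, mul_zero, Real.exp_zero, mul_one] at h; exact h
  have hfx : ∀ x y, |dX f x y| ≤ C * Real.exp (-k * |y|) := fun x y => by
    linarith [hgrad x y, abs_nonneg (dY f x y)]
  have hfy : ∀ x y, |dY f x y| ≤ C * Real.exp (-k * |y|) := fun x y => by
    linarith [hgrad x y, abs_nonneg (dX f x y)]
  have hle1 : ∀ s : ℝ, Real.exp (-k * |s|) ≤ 1 := fun s => Real.exp_le_one_iff.2 (by nlinarith [abs_nonneg s])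
  have hfC : ∀ x y, |f x y| ≤ C := fun x y => (hfb x y).trans (by nlinarith [hle1 y])
  -- continuity
  have cf : Continuous fun q : ℝ × ℝ => f q.1 q.2 := hf.continuous
  have cfx : Continuous fun q : ℝ × ℝ => dX f q.1 q.2 := continuous_dX hf
  have cfy : Continuous fun q : ℝ × ℝ => dY f q.1 q.2 := continuous_dY hf
  -- the two majorants `H₁(x,y) = L⁻¹ f² + |2 f fₓ|`, `H₂(x,y) = |2 f f_y|` and their integrability on the strip
  set H₁ : ℝ × ℝ → ℝ := fun q => L⁻¹ * f q.1 q.2 ^ 2 + |2 * f q.1 q.2 * dX f q.1 q.2| with hH₁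
  set H₂ : ℝ × ℝ → ℝ := fun q => |2 * f q.1 q.2 * dY f q.1 q.2| with hH₂
  have hwI : ∀ (F : ℝ × ℝ → ℝ) (M : ℝ), Continuous F → 0 ≤ M → (∀ x y, |F (x, y)| ≤ M * Real.exp (-k * |y|)) →
      IntegrableOn F (Ioc 0 L ×ˢ univ) := fun F M hF hM hb =>
    integrableOn_strip_of_abs_le_exp hF hM hk fun x _ y => hb x y
  have bf2 : ∀ x y, f x y ^ 2 ≤ C ^ 2 * Real.exp (-k * |y|) := fun x y => by
    have h1 := hfb x y; have h2 := hfC x y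
    calc f x y ^ 2 = |f x y| * |f x y| := by rw [← sq, sq_abs]
      _ ≤ C * (C * Real.exp (-k * |y|)) := mul_le_mul h2 h1 (abs_nonneg _) hC
      _ = C ^ 2 * Real.exp (-k * |y|) := by ring
  have bffx : ∀ x y, |2 * f x y * dX f x y| ≤ 2 * C ^ 2 * Real.exp (-k * |y|) := fun x y => by
    rw [abs_mul, abs_mul, abs_two]
    calc 2 * |f x y| * |dX f x y| ≤ 2 * C * (C * Real.exp (-k * |y|)) :=
          mul_le_mul (by linarith [hfC x y]) (hfx x y) (abs_nonneg _) (by positivity)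
      _ = 2 * C ^ 2 * Real.exp (-k * |y|) := by ring
  have bffy : ∀ x y, |2 * f x y * dY f x y| ≤ 2 * C ^ 2 * Real.exp (-k * |y|) := fun x y => by
    rw [abs_mul, abs_mul, abs_two]
    calc 2 * |f x y| * |dY f x y| ≤ 2 * C * (C * Real.exp (-k * |y|)) :=
          mul_le_mul (by linarith [hfC x y]) (hfy x y) (abs_nonneg _) (by positivity)
      _ = 2 * C ^ 2 * Real.exp (-k * |y|) := by ring
  have hLi : 0 < L⁻¹ := inv_pos.2 hL
  have iH₁ : IntegrableOn H₁ (Ioc 0 L ×ˢ univ) := by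
    refine hwI H₁ (L⁻¹ * C ^ 2 + 2 * C ^ 2) (by simp only [hH₁]; fun_prop) (by positivity) fun x y => ?_
    simp only [hH₁]
    rw [abs_of_nonneg (by positivity), add_mul]
    exact add_le_add (by rw [mul_assoc]; exact mul_le_mul_of_nonneg_left (bf2 x y) hLi.le) (bffx x y)
  have iH₂ : IntegrableOn H₂ (Ioc 0 L ×ˢ univ) := by
    refine hwI H₂ (2 * C ^ 2) (by simp only [hH₂]; fun_prop) (by positivity) fun x y => ?_
    simp only [hH₂, abs_abs]
    exact bffy x y
  have if4 : IntegrableOn (fun q : ℝ × ℝ => f q.1 q.2 ^ 4) (Ioc 0 L ×ˢ univ) := by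
    refine hwI _ (C ^ 2 * C ^ 2) (by fun_prop) (by positivity) fun x y => ?_
    rw [abs_of_nonneg (by positivity)]
    have h1 : f x y ^ 4 = f x y ^ 2 * f x y ^ 2 := by ring
    have h2 : f x y ^ 2 ≤ C ^ 2 := (bf2 x y).trans (by nlinarith [hle1 y, sq_nonneg C])
    rw [h1, mul_assoc]
    exact mul_le_mul h2 (bf2 x y) (sq_nonneg _) (sq_nonneg _)
  have if2 : IntegrableOn (fun q : ℝ × ℝ => f q.1 q.2 ^ 2) (Ioc 0 L ×ˢ univ) := by
    refine hwI _ (C ^ 2) (by fun_prop) (by positivity) fun x y => ?_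
    rw [abs_of_nonneg (by positivity)]
    exact bf2 x y
  have ifx2 : IntegrableOn (fun q : ℝ × ℝ => dX f q.1 q.2 ^ 2) (Ioc 0 L ×ˢ univ) := by
    refine hwI _ (C ^ 2) (by fun_prop) (by positivity) fun x y => ?_
    rw [abs_of_nonneg (by positivity)]
    have h1 := hfx x y
    have h2 : |dX f x y| ≤ C := h1.trans (by nlinarith [hle1 y])
    calc dX f x y ^ 2 = |dX f x y| * |dX f x y| := by rw [← sq, sq_abs]
      _ ≤ C * (C * Real.exp (-k * |y|)) := mul_le_mul h2 h1 (abs_nonneg _) hC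
      _ = C ^ 2 * Real.exp (-k * |y|) := by ring
  have ify2 : IntegrableOn (fun q : ℝ × ℝ => dY f q.1 q.2 ^ 2) (Ioc 0 L ×ˢ univ) := by
    refine hwI _ (C ^ 2) (by fun_prop) (by positivity) fun x y => ?_
    rw [abs_of_nonneg (by positivity)]
    have h1 := hfy x y
    have h2 : |dY f x y| ≤ C := h1.trans (by nlinarith [hle1 y])
    calc dY f x y ^ 2 = |dY f x y| * |dY f x y| := by rw [← sq, sq_abs]
      _ ≤ C * (C * Real.exp (-k * |y|)) := mul_le_mul h2 h1 (abs_nonneg _) hC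
      _ = C ^ 2 * Real.exp (-k * |y|) := by ring
  -- the marginals `a(y) = ∫ H₁(·,y)`, `b(x) = ∫ H₂(x,·)`
  set a : ℝ → ℝ := fun y => ∫ x in Ioc 0 L, H₁ (x, y) with ha
  set b : ℝ → ℝ := fun x => ∫ y, H₂ (x, y) with hb
  have iH₁' : Integrable H₁ ((volume.restrict (Ioc 0 L)).prod volume) := by
    rw [← volume_restrict_strip]; exact iH₁
  have iH₂' : Integrable H₂ ((volume.restrict (Ioc 0 L)).prod volume) := by
    rw [← volume_restrict_strip]; exact iH₂
  have ia : Integrable a := iH₁'.integral_prod_right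
  have ib : Integrable b (volume.restrict (Ioc 0 L)) := iH₂'.integral_prod_left
  -- pointwise: `f⁴ ≤ a(y) b(x)` on the strip
  have hpt : ∀ q ∈ Ioc (0:ℝ) L ×ˢ (univ : Set ℝ), f q.1 q.2 ^ 4 ≤ b q.1 * a q.2 := by
    rintro ⟨x, y⟩ ⟨hx, -⟩
    have h1 : f x y ^ 2 ≤ a y := by
      have h := kato_sq_le_mean_add_variation hL hf (Ioc_subset_Icc_self hx) y
      simp only [ha, hH₁]
      rw [integral_add, integral_const_mul]
      · exact h
      · exact ((cf.comp (continuous_id.prodMk continuous_const)).pow 2).integrableOn_Ioc.const_mul _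
      · exact (Continuous.integrableOn_Ioc (by fun_prop))
    have h2 : f x y ^ 2 ≤ b x := kato_sq_le_integral_dY hk hf hfb hfy x y
    have e : f x y ^ 4 = f x y ^ 2 * f x y ^ 2 := by ring
    rw [e, mul_comm (b x)]
    exact mul_le_mul h1 h2 (sq_nonneg _) ((sq_nonneg _).trans h1)
  -- integrate: `∫∫ f⁴ ≤ (∫ b)(∫ a)`
  have hS : MeasurableSet (Ioc (0:ℝ) L ×ˢ (univ : Set ℝ)) := measurableSet_Ioc.prod MeasurableSet.univ
  have iab : IntegrableOn (fun q : ℝ × ℝ => b q.1 * a q.2) (Ioc 0 L ×ˢ univ) := by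
    rw [IntegrableOn, volume_restrict_strip]; exact ib.mul_prod ia
  have step1 : ∫ q in Ioc 0 L ×ˢ univ, f q.1 q.2 ^ 4 ≤ (∫ x in Ioc 0 L, b x) * ∫ y, a y := by
    calc ∫ q in Ioc 0 L ×ˢ univ, f q.1 q.2 ^ 4 ≤ ∫ q in Ioc 0 L ×ˢ univ, b q.1 * a q.2 :=
          setIntegral_mono_on if4 iab hS hpt
      _ = (∫ x in Ioc 0 L, b x) * ∫ y, a y := by
          rw [volume_restrict_strip, integral_prod_mul (μ := volume.restrict (Ioc 0 L)) (ν := volume) b a]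
  -- evaluate the marginal integrals by Fubini and bound them by Cauchy–Schwarz
  have iffx : IntegrableOn (fun q : ℝ × ℝ => |2 * f q.1 q.2 * dX f q.1 q.2|) (Ioc 0 L ×ˢ univ) := by
    refine hwI _ (2 * C ^ 2) (by fun_prop) (by positivity) fun x y => ?_
    rw [abs_abs]
    exact bffx x y
  have hCSx : ∫ q in Ioc 0 L ×ˢ univ, |2 * f q.1 q.2 * dX f q.1 q.2| ≤
      2 * Real.sqrt (∫ q in Ioc 0 L ×ˢ univ, f q.1 q.2 ^ 2) * Real.sqrt (∫ q in Ioc 0 L ×ˢ univ, dX f q.1 q.2 ^ 2) := by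
    have e : (fun q : ℝ × ℝ => |2 * f q.1 q.2 * dX f q.1 q.2|) = fun q => 2 * (|f q.1 q.2| * |dX f q.1 q.2|) := by
      funext q; rw [abs_mul, abs_mul, abs_two]; ring
    rw [e, integral_const_mul, mul_assoc]
    exact mul_le_mul_of_nonneg_left (kato_strip_cauchySchwarz (φ := fun q => f q.1 q.2)
      (χ := fun q => dX f q.1 q.2) cf cfx if2 ifx2) zero_le_two
  have hCSy : ∫ q in Ioc 0 L ×ˢ univ, |2 * f q.1 q.2 * dY f q.1 q.2| ≤
      2 * Real.sqrt (∫ q in Ioc 0 L ×ˢ univ, f q.1 q.2 ^ 2) * Real.sqrt (∫ q in Ioc 0 L ×ˢ univ, dY f q.1 q.2 ^ 2) := by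
    have e : (fun q : ℝ × ℝ => |2 * f q.1 q.2 * dY f q.1 q.2|) = fun q => 2 * (|f q.1 q.2| * |dY f q.1 q.2|) := by
      funext q; rw [abs_mul, abs_mul, abs_two]; ring
    rw [e, integral_const_mul, mul_assoc]
    exact mul_le_mul_of_nonneg_left (kato_strip_cauchySchwarz (φ := fun q => f q.1 q.2)
      (χ := fun q => dY f q.1 q.2) cf cfy if2 ify2) zero_le_two
  have hA : ∫ y, a y ≤ L⁻¹ * (∫ q in Ioc 0 L ×ˢ univ, f q.1 q.2 ^ 2) +
      2 * Real.sqrt (∫ q in Ioc 0 L ×ˢ univ, f q.1 q.2 ^ 2) * Real.sqrt (∫ q in Ioc 0 L ×ˢ univ, dX f q.1 q.2 ^ 2) := by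
    have e1 : ∫ y, a y = ∫ q in Ioc 0 L ×ˢ univ, H₁ q := by
      rw [volume_restrict_strip, integral_prod_symm _ iH₁']
    rw [e1]
    simp only [hH₁]
    rw [integral_add (if2.const_mul _) iffx, integral_const_mul]
    linarith [hCSx]
  have hB : ∫ x in Ioc 0 L, b x ≤
      2 * Real.sqrt (∫ q in Ioc 0 L ×ˢ univ, f q.1 q.2 ^ 2) * Real.sqrt (∫ q in Ioc 0 L ×ˢ univ, dY f q.1 q.2 ^ 2) := by
    have e1 : ∫ x in Ioc 0 L, b x = ∫ q in Ioc 0 L ×ˢ univ, H₂ q := by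
      rw [volume_restrict_strip, integral_prod _ iH₂']
    rw [e1]
    exact hCSy
  have ha0 : 0 ≤ ∫ y, a y := integral_nonneg fun y =>
    setIntegral_nonneg measurableSet_Ioc fun x _ => by simp only [hH₁]; positivity
  have hb0 : 0 ≤ ∫ x in Ioc 0 L, b x := setIntegral_nonneg measurableSet_Ioc fun x _ =>
    integral_nonneg fun y => by simp only [hH₂]; positivity
  calc ∫ q in Ioc 0 L ×ˢ univ, f q.1 q.2 ^ 4 ≤ (∫ x in Ioc 0 L, b x) * ∫ y, a y := step1
    _ ≤ (2 * Real.sqrt (∫ q in Ioc 0 L ×ˢ univ, f q.1 q.2 ^ 2) * Real.sqrt (∫ q in Ioc 0 L ×ˢ univ, dY f q.1 q.2 ^ 2)) *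
        (L⁻¹ * (∫ q in Ioc 0 L ×ˢ univ, f q.1 q.2 ^ 2) +
          2 * Real.sqrt (∫ q in Ioc 0 L ×ˢ univ, f q.1 q.2 ^ 2) * Real.sqrt (∫ q in Ioc 0 L ×ˢ univ, dX f q.1 q.2 ^ 2)) :=
        mul_le_mul hB hA ha0 (by positivity)
    _ = _ := by ring

end Ladyzhenskaya

end Summit.AnomalousDissipation.AnomalousDissipation.Theorems.StrainedLayerLaw.StrainWorkSumRule

end
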